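import Mathlib.MeasureTheory.Constructions.Pi
import Mathlib.MeasureTheory.Measure.Lebesgue.Basic
import Mathlib.MeasureTheory.Measure.Prod
import Mathlib.MeasureTheory.Integral.Lebesgue.Basic
import HarnessLib

/-!
# Volume of a thin slab in a box, through one transversal coordinate

A measure-theoretic tool for the "measure arguments" of K. Ford, J. Maynard, *On the theory of
prime producing sieves* (arXiv:2407.14368): in the proofs of Theorem 6.3 (a) ((fh1), §6.2) and of
Theorem 9.1 (§9) one bounds the measure of the fragmentations `(u_{j,i})` for which some mixed
subsum lies in a short interval by fixing all variables but one, `u_{j',i'}`, in which the subsum is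
affine with slope `±1` ("the measure of `u_{j',i'}` with `A ∈ [θ, θ+ν]` is `≤ ν`"). Everything here is
PROVED:

* `volume_toReal_le_of_section` — if `S ⊆ [0, R]^{n+1}` is measurable and a function `Φ`, affine
  with slope `±1` in the coordinate `p`, takes values in an interval of length `w` on `S`, then
  `vol(S) ≤ 2 w R^n`;
* `volume_toReal_le_of_section'` — the same for an arbitrary finite index type.

## References

* K. Ford, J. Maynard, *On the theory of prime producing sieves*, arXiv:2407.14368v1 (2024), §6.2
  (proof of (fh1)) and §9 (proof of Theorem 9.1). [FordMaynard2024PrimeSieves]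
-/

noncomputable section

open MeasureTheory Set

namespace Literature.NumberTheory.Sieve.FordMaynard

/-- The symm of `piFinSuccAbove` is `Fin.insertNth`. [folklore] -/
theorem piFinSuccAbove_symm_apply' {n : ℕ} (p : Fin (n + 1)) (x : ℝ) (y : Fin n → ℝ) :
    (MeasurableEquiv.piFinSuccAbove (fun _ => ℝ) p).symm (x, y) = Fin.insertNth p x y := rfl

/-- **Slab through one coordinate.** Let `S ⊆ [0, R]^{n+1}` be measurable, and let `Φ` be a
function with `Φ(U[p ↦ u]) = Φ(U) + s (u − U_p)`, `s = ±1`, taking values in `[lo, lo + w]` on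
`S`. Then `vol(S) ≤ 2 w Rⁿ`. [cite: FordMaynard2024PrimeSieves, §9 (proof of Theorem 9.1, "the measure of u_{j',i'} with A ∈ [θ,θ+ν] is ≤ ν")] -/
theorem volume_toReal_le_of_section {n : ℕ} (p : Fin (n + 1)) {S : Set (Fin (n + 1) → ℝ)}
    (hS : MeasurableSet S) {R w lo : ℝ} (hR : 0 ≤ R) (hw : 0 ≤ w)
    (hbox : ∀ U ∈ S, ∀ q, U q ∈ Set.Icc 0 R) (Φ : (Fin (n + 1) → ℝ) → ℝ) {s : ℝ}
    (hs : s = 1 ∨ s = -1) (hΦ : ∀ U u, Φ (Function.update U p u) = Φ U + s * (u - U p))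
    (hslab : ∀ U ∈ S, lo ≤ Φ U ∧ Φ U ≤ lo + w) :
    (volume S).toReal ≤ 2 * w * R ^ n := by
  set e := MeasurableEquiv.piFinSuccAbove (fun _ : Fin (n + 1) => ℝ) p with he
  have hmp : MeasurePreserving e.symm ((volume : Measure ℝ).prod volume) volume :=
    (volume_preserving_piFinSuccAbove (fun _ : Fin (n + 1) => ℝ) p).symm
  set T : Set (ℝ × (Fin n → ℝ)) := e.symm ⁻¹' S with hT
  have hTm : MeasurableSet T := e.symm.measurable hS
  have hvol : volume S = ((volume : Measure ℝ).prod volume) T :=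
    (hmp.measure_preimage hS.nullMeasurableSet).symm
  -- sections in the coordinate `p`
  have hsec : ∀ y : Fin n → ℝ, (volume : Measure ℝ) ((fun x => (x, y)) ⁻¹' T) ≤
      ENNReal.ofReal (2 * w) * (Set.pi Set.univ fun _ : Fin n => Set.Icc 0 R).indicator 1 y := by
    intro y
    by_cases hne : ((fun x : ℝ => (x, y)) ⁻¹' T).Nonempty
    · obtain ⟨x₀, hx₀⟩ := hne
      have hx₀S : Fin.insertNth p x₀ y ∈ S := by
        have : e.symm (x₀, y) ∈ S := hx₀
        rwa [he, piFinSuccAbove_symm_apply'] at this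
      have hy : y ∈ Set.pi Set.univ fun _ : Fin n => Set.Icc 0 R := by
        intro i _
        have := hbox _ hx₀S (p.succAbove i)
        rwa [Fin.insertNth_apply_succAbove] at this
      rw [Set.indicator_of_mem hy, Pi.one_apply, mul_one]
      -- the section lies in an interval of length `2w` around `x₀`
      have hsub : (fun x : ℝ => (x, y)) ⁻¹' T ⊆ Set.Icc (x₀ - w) (x₀ + w) := by
        intro x hx
        have hxS : Fin.insertNth p x y ∈ S := by
          have : e.symm (x, y) ∈ S := hx
          rwa [he, piFinSuccAbove_symm_apply'] at this
        have hupd : (Fin.insertNth p x y : Fin (n + 1) → ℝ) =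
            Function.update (Fin.insertNth p x₀ y : Fin (n + 1) → ℝ) p x :=
          (Fin.update_insertNth (α := fun _ => ℝ) p x₀ x y).symm
        have h1 := hslab _ hxS
        have h0 := hslab _ hx₀S
        rw [hupd, hΦ, Fin.insertNth_apply_same] at h1
        rw [Set.mem_Icc]
        rcases hs with hs1 | hs1 <;> rw [hs1] at h1 <;> constructor <;> nlinarith
      calc (volume : Measure ℝ) ((fun x => (x, y)) ⁻¹' T) ≤ volume (Set.Icc (x₀ - w) (x₀ + w)) :=
            measure_mono hsub
        _ = ENNReal.ofReal (2 * w) := by rw [Real.volume_Icc]; ring_nf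
    · rw [Set.not_nonempty_iff_eq_empty.1 hne, measure_empty]
      exact bot_le
  rw [hvol, Measure.prod_apply_symm hTm]
  have hbox_meas : MeasurableSet (Set.pi Set.univ fun _ : Fin n => Set.Icc (0 : ℝ) R) :=
    MeasurableSet.univ_pi fun _ => measurableSet_Icc
  calc (∫⁻ y, (volume : Measure ℝ) ((fun x => (x, y)) ⁻¹' T)).toReal
      ≤ (∫⁻ y : Fin n → ℝ, ENNReal.ofReal (2 * w) *
          (Set.pi Set.univ fun _ : Fin n => Set.Icc 0 R).indicator 1 y).toReal := by
        refine ENNReal.toReal_mono ?_ (lintegral_mono hsec)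
        rw [lintegral_const_mul _ (measurable_one.indicator hbox_meas), lintegral_indicator_one hbox_meas]
        exact ENNReal.mul_ne_top ENNReal.ofReal_ne_top
          (lt_of_le_of_lt (measure_mono (Set.pi_univ_Icc _ _).le) (isCompact_Icc.measure_lt_top)).ne
    _ = 2 * w * R ^ n := by
        rw [lintegral_const_mul _ (measurable_one.indicator hbox_meas), lintegral_indicator_one hbox_meas,
          volume_pi_pi]
        simp only [Real.volume_Icc, sub_zero, Finset.prod_const, Finset.card_univ, Fintype.card_fin]
        rw [ENNReal.toReal_mul, ENNReal.toReal_ofReal (by positivity), ENNReal.toReal_pow,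
          ENNReal.toReal_ofReal hR]

/-- Re-indexing the coordinates preserves Lebesgue measure: `vol{U | U ∘ e ∈ S} = vol S`.
[folklore] -/
theorem volume_comp_equiv_preimage {ι ι' : Type*} [Fintype ι] [Fintype ι'] (e : ι ≃ ι')
    (S : Set (ι → ℝ)) (hS : MeasurableSet S) :
    volume {U' : ι' → ℝ | U' ∘ e ∈ S} = volume S := by
  have hmp := volume_measurePreserving_piCongrLeft (fun _ : ι' => ℝ) e
  -- `piCongrLeft e : (ι → ℝ) ≃ (ι' → ℝ)`, `(piCongrLeft e).symm U' = U' ∘ e`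
  have hsymm : ∀ U' : ι' → ℝ, (MeasurableEquiv.piCongrLeft (fun _ : ι' => ℝ) e).symm U' = U' ∘ e := by
    intro U'; funext q
    show (Equiv.piCongrLeft (fun _ : ι' => ℝ) e).symm U' q = U' (e q)
    rw [Equiv.piCongrLeft_symm_apply]
  have : {U' : ι' → ℝ | U' ∘ e ∈ S} = (MeasurableEquiv.piCongrLeft (fun _ : ι' => ℝ) e).symm ⁻¹' S := by
    ext U'; simp [hsymm]
  rw [this]
  exact hmp.symm.measure_preimage hS.nullMeasurableSet

/-- **Slab through one coordinate, arbitrary finite index type.** [cite: FordMaynard2024PrimeSieves, §9 (proof of Theorem 9.1)] -/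
theorem volume_toReal_le_of_section' {ι : Type*} [Fintype ι] [DecidableEq ι] (q₀ : ι)
    {S : Set (ι → ℝ)} (hS : MeasurableSet S) {R w lo : ℝ} (hR : 0 ≤ R) (hw : 0 ≤ w)
    (hbox : ∀ U ∈ S, ∀ q, U q ∈ Set.Icc 0 R) (Φ : (ι → ℝ) → ℝ) {s : ℝ} (hs : s = 1 ∨ s = -1)
    (hΦ : ∀ U u, Φ (Function.update U q₀ u) = Φ U + s * (u - U q₀))
    (hslab : ∀ U ∈ S, lo ≤ Φ U ∧ Φ U ≤ lo + w) :
    (volume S).toReal ≤ 2 * w * R ^ (Fintype.card ι - 1) := by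
  classical
  -- `card ι = n + 1`
  obtain ⟨n, hn⟩ : ∃ n, Fintype.card ι = n + 1 :=
    ⟨Fintype.card ι - 1, (Nat.succ_pred_eq_of_pos (Fintype.card_pos_iff.2 ⟨q₀⟩)).symm⟩
  rw [hn, Nat.add_sub_cancel]
  set e : ι ≃ Fin (n + 1) := (Fintype.equivFin ι).trans (finCongr hn) with he
  set p : Fin (n + 1) := e q₀ with hp
  set S' : Set (Fin (n + 1) → ℝ) := {U' | U' ∘ e ∈ S} with hS'
  have hS'm : MeasurableSet S' := by
    have hmeas : Measurable fun U' : Fin (n + 1) → ℝ => U' ∘ e :=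
      measurable_pi_lambda _ fun q => measurable_pi_apply _
    exact hmeas hS
  have hvol : volume S' = volume S := volume_comp_equiv_preimage e S hS
  rw [← hvol]
  refine volume_toReal_le_of_section p hS'm hR hw (fun U' hU' q' => ?_) (fun U' => Φ (U' ∘ e)) hs
    (fun U' u => ?_) (fun U' hU' => hslab _ hU')
  · have := hbox _ hU' (e.symm q')
    simpa using this
  · show Φ (Function.update U' p u ∘ e) = Φ (U' ∘ e) + s * (u - (U' ∘ e) q₀)
    rw [hp, Function.update_comp_eq_of_injective _ e.injective]
    exact hΦ _ _

end Literature.NumberTheory.Sieve.FordMaynard
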